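import Literature.IUT.HodgeArakelov.BadPrimeGaussianMonoidsTorsionUnitsModelProofs
import Literature.IUT.HodgeArakelov.ThetaEnvDataRecordModel

/-!
# [IUTchII] Cor 1.12 / Prop 3.1 / Cor 3.5 AT THE GENUINE RECORD: `M^μ_TM ⊆ M^×_TM` for
# `EtaleLevels.thetaEnvRecordKummer` (the Prop 3.1 input record of the NATURAL system `𝕄_*` of `X̲̲_K` with
# `Ψ_cns :=` the Kummer image of `𝒪^▷`) — proof-only instantiation of `…TorsionUnitsModelProofs.lean`

S. Mochizuki, *Inter-universal Teichmüller theory II*, kurims Dec-2020 manuscript: Cor 1.12 p. 56 ("`M^μ_TM(−) ⊆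
M^×_TM(−)` denotes the submodule of torsion elements"), Prop 3.1 (ii) p. 88 [cite: Mochizuki2012, Prop 3.1 (ii) p.88];
classical content: the torsion of `lim_{k′} H¹(G_{k′}, Ẑ(1))` is `κ(μ(k̄))` [cite: NeukirchSchmidtWingberg2008, II §7].
Claim key DISPUTED (D-0012). PROOF-ONLY companion (abc-iut cell, layer L6, seat abc-iut-w4-d004 gen 2; node
IUTchII:Cor3.5(ii), binder `htors`; Cor 1.12 binder `hμ`). NO definition, NO `Prop` fact.

For abc-iut-w4-d019's GENUINE record `EtaleLevels.thetaEnvRecordKummer … c hA hfi O ι₀` (`ThetaEnvDataRecordModel.lean`: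
ambient module = abc-iut-L6-t1's genuine limit `lim_J H¹(Π^tp_{Ÿ̲̲} ∩ J, l·Δ_Θ)`, `Ψ_cns :=` abc-iut-w4-d007's
`h1LimKummerOn c hA hfi O`, the Kummer image of a `Π^tp_{X̲̲}`-stable constant monoid `O ≤ A` — `𝒪^▷_{k̄} ≤ k̄ˣ` —
through the cyclotomic-rigidity coefficient datum `c : Λ(A) → l·Δ_Θ`): if `c` is bijective (the printed cyclotomic
rigidity ISOMORPHISM) and `O` contains every torsion element of `A` together with its inverse (roots of unity are units
of `𝒪`; at the MLF model L4 `mem_unitSubmonoid_of_pow_eq_one`), then **every torsion element of the record's ambient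
module lies in `M^×_TM`** (`units_of_isOfFinOrder_thetaEnvRecordKummer`) — the junction hypothesis `htors`/`hμ` of
the Cor 1.12 / Cor 3.5 (ii) files DISCHARGED at the genuine record (identification `ψ = id`, `κ = h1LimKummerOn` by
`rfl`). Nothing here asserts a disputed claim or takes a side on [IUTchIII] Cor 3.12; typed ≠ proved ≠ endorsed.
-/

noncomputable section

namespace Literature.IUT.HodgeArakelov

namespace EtaleLevels

open Literature.AnabelianGeometry.EtaleTheta CohomologySystemOfContH1 EtaleThetaDataOfSetting

variable {p : ℕ} [Fact p.Prime] {D : Literature.AnabelianGeometry.EtaleTheta.ThetaSetting p}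
  {E : D.EtaleThetaData} {l : ℕ} (C : E.DoubleUnderline l) (hC : D.Compat) (hS : D.Sec2Hyps)
  (hl : l.Prime) (hp2 : p ≠ 2) (hpl : p ≠ l) (hζ : ∃ ζ : D.K, IsPrimitiveRoot ζ (4 * l))
  (mods : ∀ M : ℕ+, D.CyclotomeMod l M)
  (f : contCocycles D.toTheta D.DeltaTheta C.GtpYdduu) (hf : f ∈ C.rootCocycles hC)
  (hmods : ∀ (M M' : ℕ+) (h : (M : ℕ) ∣ (M' : ℕ)) (x : D.lDeltaTheta l),
    MuN.red p M M' h ((mods M').red x) = (mods M).red x)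
  (h15 : Literature.AnabelianGeometry.EtaleTheta.ThetaSetting.Prop15iii E hC) (L : C.CuspLabels)
  (hZ : ∀ M : ℕ+, Nonempty (ModelCyclotomes.lDeltaQuot (C.rigidData (mods M) hC hS h15 L) ≃*
    Literature.IUT.HodgeTheaters.ZHat))
  (hcharY : EtaleThetaDataOfSetting.PiYddCharacteristic C)
  (hlim : Function.Bijective (rigidLimHom C hC hS hl hp2 hpl hζ mods f hf hmods h15 L hZ))
  [(EtaleThetaDataOfSetting.PiYdd C).Normal]
  {A : Type} [CommGroup A] [MulDistribMulAction (Pi C) A] [TopologicalSpace A] [RootableBy A ℕ]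
  (c : CyclotomeCoefficients (phi C) (D.lDeltaTheta l) A)
  (hA : ∀ b : A, IsOpen (MulAction.stabilizer (Pi C) b : Set (Pi C)))
  (hfi : ∀ b : A, (MulAction.stabilizer (Pi C) b).FiniteIndex)
  (O : Submonoid A) (ι₀ : Pi C)

/-- **`M^μ_TM ⊆ M^×_TM` for the genuine record** `thetaEnvRecordKummer`: every torsion element of the ambient module
`lim_J H¹(Π^tp_{Ÿ̲̲} ∩ J, l·Δ_Θ)` lies in the unit group `M^×_TM` of `Ψ_cns = κ(𝒪^▷)` — for bijective cyclotomic-rigidity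
coefficients `c` and a constant monoid `O` containing the roots of unity with their inverses. The binder
`htors`/`hμ` of the Cor 1.12 / Cor 3.5 (ii) files, at the genuine record. [cite: NeukirchSchmidtWingberg2008, II §7] -/
theorem units_of_isOfFinOrder_thetaEnvRecordKummer (hc : Function.Bijective c.hom)
    (hOtors : ∀ a : A, IsOfFinOrder a → a ∈ O ∧ a⁻¹ ∈ O)
    (x : (thetaEnvRecordKummer C hC hS hl hp2 hpl hζ mods f hf hmods h15 L hZ hcharY hlim c hA hfi O ι₀).H)
    (hx : IsOfFinOrder x) :
    x ∈ (thetaEnvRecordKummer C hC hS hl hp2 hpl hζ mods f hf hmods h15 L hZ hcharY hlim c hA hfi O ι₀).units :=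
  BadPrimeGaussianMonoids.units_of_isOfFinOrder_ofKummerModel
    (thetaEnvRecordKummer C hC hS hl hp2 hpl hζ mods f hf hmods h15 L hZ hcharY hlim c hA hfi O ι₀)
    (phi C) (D.lDeltaTheta l) (PiYdd C) c hA hfi (MulEquiv.refl _) O
    (h1LimKummerOn (phi C) (D.lDeltaTheta l) (PiYdd C) c hA hfi O) (fun _ => rfl)
    (ThetaEnvData.toRecord_constantMonoid _ _ _ _) hc hOtors x hx

/-- The same in binder shape (`htors : ∀ u, IsOfFinOrder u → u ∈ E.units`). [cite: Mochizuki2012, Prop 3.1 (ii) p.88] -/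
theorem htors_thetaEnvRecordKummer (hc : Function.Bijective c.hom)
    (hOtors : ∀ a : A, IsOfFinOrder a → a ∈ O ∧ a⁻¹ ∈ O) :
    ∀ x : (thetaEnvRecordKummer C hC hS hl hp2 hpl hζ mods f hf hmods h15 L hZ hcharY hlim c hA hfi O ι₀).H,
      IsOfFinOrder x →
        x ∈ (thetaEnvRecordKummer C hC hS hl hp2 hpl hζ mods f hf hmods h15 L hZ hcharY hlim c hA hfi O ι₀).units :=
  fun x hx => units_of_isOfFinOrder_thetaEnvRecordKummer C hC hS hl hp2 hpl hζ mods f hf hmods h15 L hZ hcharY hlim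
    c hA hfi O ι₀ hc hOtors x hx

end EtaleLevels

end Literature.IUT.HodgeArakelov
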